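import Summits.CriticalPhenomena.PercolationContinuityZ3.Theorems.Transplant.PlanarSkeletonCentralShift
import HarnessLib

/-!
# A centralised skeleton translation from a GROUP ACTION: one element `z` of an acting group that shifts a skeleton coordinate and whose
# centraliser has finitely many orbits — Φ2 for every periodic lattice skeleton in one line (abelian actions: automatic)

builds on p205010 (kernel theorem, internal audit signed; external expert review pending) — nothing in this file uses p205010 except the
unconditional corollaries through the closed D″ node (`criticalContinuity_of_action`, `criticalContinuity_of_commAction`).
Lane `prim-bschramm`, seat `prim-bschramm-p4` (gen 9; PART C3, METHOD = abstract closing argument); helper file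
(`--supports stmt-CriticalPhenomena-4575 --as helper`).  Memo `HOME/bschramm/P4-GENERAL.md` §25.1.  API complement of `PlanarSkeletonCentralShift`.

THE POINT.  `PlanarSkeletonNeg.CentralShift` asks for an automorphism `τ` with `φ_{i₀} ∘ τ = φ_{i₀} + M` and a cofinite family of automorphisms
commuting with it.  When a group `H` acts on `G` by automorphisms (`IsActionByAut`), an element `z ∈ H` with `φ_{i₀}(z • w) = φ_{i₀}(w) + M`
(`M ≠ 0`) whose CENTRALISER moves every vertex into a finite set gives exactly this (`CentralShift.ofAction`); for a COMMUTATIVE `H` with finitely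
many orbits the centraliser condition is free (`CentralShift.ofCommAction`).  Consequence: **every connected locally finite graph with a
`PlanarSkeletonSign` whose frames come from a cofinite action of an abelian group (every `ℤ^d`-periodic lattice skeleton of the lane's
catalogues, every Cayley graph of an abelian group) has Φ2 at `p_c` for free and `θ_v(p_c) = 0` unconditionally** (`criticalContinuity_of_commAction`)
— the per-lattice thin-fibre / Lipschitz-height proofs of Φ2 become unnecessary wherever one lattice translation moves the skeleton.
* §1 `CentralShift.ofAction`, `CentralShift.ofCommAction`; §2 `criticalContinuity_of_action`, `criticalContinuity_of_commAction` (+ the N1-conditional twin).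
[cite: MartineauSevero2019, Cor. 2.2] [cite: BenjaminiSchramm1996, §2 (quotients by subgroups of automorphisms); Conj. 4]
-/

noncomputable section

namespace Summit.CriticalPhenomena.PercolationContinuityZ3.Theorems.Transplant

open MeasureTheory Literature.Probability.Percolation Literature.Probability.LatticeModels
open scoped Classical

namespace PlanarSkeletonNeg

variable {V : Type} {G : SimpleGraph V} [G.LocallyFinite] (Φ : PlanarSkeletonNeg G)
variable {H : Type} [Group H] [MulAction H V]

/-! ## §1 Constructors -/

/-- **A centralised translation from an action by automorphisms**: `z ∈ H` shifting `φ_{i₀}` by `M ≠ 0`, with a finite set `V₀` into which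
the CENTRALISER of `z` moves every vertex. [cite: MartineauSevero2019, Cor. 2.2] [cite: BenjaminiSchramm1996, §2] -/
def CentralShift.ofAction (hact : IsActionByAut G H) (z : H) (i₀ : Fin 2) (M : ℤ) (hM : M ≠ 0)
    (hshift : ∀ w : V, Φ.φ (z • w) i₀ = Φ.φ w i₀ + M) (V₀ : Finset V)
    (hcof : ∀ v : V, ∃ c : H, c * z = z * c ∧ c • v ∈ V₀) : Φ.CentralShift where
  τ := smulIso hact z
  i₀ := i₀
  M := M
  M_ne := hM
  shift := fun w => by rw [smulIso_apply]; exact hshift w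
  V₀ := V₀
  comm := fun v => by
    obtain ⟨c, hcz, hcv⟩ := hcof v
    refine ⟨smulIso hact c, fun w => ?_, by rw [smulIso_apply]; exact hcv⟩
    show c • (z • w) = z • (c • w)
    rw [← mul_smul, hcz, mul_smul]

/-- **… from a COMMUTATIVE action with finitely many orbits**: the centraliser condition is free (`c := the element carrying v into V₀`).
[cite: BenjaminiSchramm1996, §2] -/
def CentralShift.ofCommAction {H : Type} [CommGroup H] [MulAction H V] (hact : IsActionByAut G H) (z : H) (i₀ : Fin 2) (M : ℤ)
    (hM : M ≠ 0) (hshift : ∀ w : V, Φ.φ (z • w) i₀ = Φ.φ w i₀ + M) (V₀ : Finset V) (horb : ∀ v : V, ∃ c : H, c • v ∈ V₀) :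
    Φ.CentralShift :=
  CentralShift.ofAction Φ hact z i₀ M hM hshift V₀ fun v => by
    obtain ⟨c, hc⟩ := horb v
    exact ⟨c, mul_comm c z, hc⟩

/-! ## §2 The continuity corollaries -/

/-- **CONDITIONAL (N1): one-type `PlanarSkeletonNeg` + an action element shifting the skeleton with cofinite centraliser ⟹ `θ_v(p_c) = 0`**,
modulo `SamePDropOfSkeletonNeg₁`. [cite: BenjaminiSchramm1996, Conj. 4] [cite: MartineauSevero2019, Cor. 2.2] -/
theorem criticalContinuity_of_negNode₁_action (hD : SamePDropOfSkeletonNeg₁) {t : V} (h1 : Φ.types = {t}) (hact : IsActionByAut G H)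
    (z : H) (i₀ : Fin 2) (M : ℤ) (hM : M ≠ 0) (hshift : ∀ w : V, Φ.φ (z • w) i₀ = Φ.φ w i₀ + M) (V₀ : Finset V)
    (hcof : ∀ v : V, ∃ c : H, c * z = z * c ∧ c • v ∈ V₀) (v : V) : theta G v (criticalProbIOf G v) = 0 :=
  Φ.criticalContinuity_of_negNode₁_centralShift hD h1 (CentralShift.ofAction Φ hact z i₀ M hM hshift V₀ hcof) v

end PlanarSkeletonNeg

/-- **THEOREM (unconditional): a `PlanarSkeletonSign` graph acted on by automorphisms, with one acting element shifting a skeleton coordinate and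
having cofinite centraliser, has `θ_v(p_c) = 0` at every vertex.**  builds on p205010 (kernel theorem, internal audit signed; external expert review pending).
[cite: BenjaminiSchramm1996, Conj. 4] [cite: MartineauSevero2019, Cor. 2.2] -/
theorem PlanarSkeletonSign.criticalContinuity_of_action {V : Type} {G : SimpleGraph V} [G.LocallyFinite] (Φ : PlanarSkeletonSign G)
    {H : Type} [Group H] [MulAction H V] (hact : IsActionByAut G H) (z : H) (i₀ : Fin 2) (M : ℤ) (hM : M ≠ 0)
    (hshift : ∀ w : V, Φ.φ (z • w) i₀ = Φ.φ w i₀ + M) (V₀ : Finset V) (hcof : ∀ v : V, ∃ c : H, c * z = z * c ∧ c • v ∈ V₀) (v : V) :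
    theta G v (criticalProbIOf G v) = 0 :=
  Φ.criticalContinuity_of_centralShift (PlanarSkeletonNeg.CentralShift.ofAction Φ.toPlanarSkeletonNeg hact z i₀ M hM hshift V₀ hcof) v

/-- **THEOREM (unconditional, abelian actions): a `PlanarSkeletonSign` graph with a cofinite action of a COMMUTATIVE group by automorphisms, one
of whose elements shifts a skeleton coordinate, has `θ_v(p_c) = 0` at every vertex** — every `ℤ^d`-periodic lattice skeleton of the lane.
builds on p205010 (kernel theorem, internal audit signed; external expert review pending). [cite: BenjaminiSchramm1996, Conj. 4] [cite: MartineauSevero2019, Cor. 2.2] -/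
theorem PlanarSkeletonSign.criticalContinuity_of_commAction {V : Type} {G : SimpleGraph V} [G.LocallyFinite] (Φ : PlanarSkeletonSign G)
    {H : Type} [CommGroup H] [MulAction H V] (hact : IsActionByAut G H) (z : H) (i₀ : Fin 2) (M : ℤ) (hM : M ≠ 0)
    (hshift : ∀ w : V, Φ.φ (z • w) i₀ = Φ.φ w i₀ + M) (V₀ : Finset V) (horb : ∀ v : V, ∃ c : H, c • v ∈ V₀) (v : V) :
    theta G v (criticalProbIOf G v) = 0 :=
  Φ.criticalContinuity_of_centralShift (PlanarSkeletonNeg.CentralShift.ofCommAction Φ.toPlanarSkeletonNeg hact z i₀ M hM hshift V₀ horb) v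

end Summit.CriticalPhenomena.PercolationContinuityZ3.Theorems.Transplant

end
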